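import Literature.NumberTheory.LFunctions.WeilConjecturesFunctionalEquationLowDimProofs
import HarnessLib

/-!
# The Weil conjectures for `Z(X, T)` from the cohomological formalism and Deligne's theorem

The named fact `Literature.NumberTheory.LFunctions.exists_isWeilFactorization`
(`WeilConjectures.lean`, **rh.S37**; Weil 1949; Deligne, *La conjecture de Weil. I*, Publ. Math.
IHÉS 43 (1974), Thm. (1.6)) says: for `X` smooth projective (geometrically irreducible) of
dimension `n` over the finite field `k`, `q = #k`, there are `P₀, …, P₂ₙ ∈ ℤ[T]`, `Pᵢ(0) = 1`,
`P₀ = 1 - T`, `P₂ₙ = 1 - qⁿT`, with `Z(X, T) · ∏_{i even} Pᵢ = ∏_{i odd} Pᵢ` and all complex roots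
of `Pᵢ` of absolute value `q^{-i/2}` (`Literature.AlgebraicGeometry.Motives.IsWeilFactorization`).

This file proves the fact *from the cohomological formalism together with Deligne's theorem*,
following the printed architecture of Deligne's paper, §§1–2:

* (1.5.4) `Z(X₀, t) = ∏ᵢ det(1 - F*t, Hⁱ(X, ℚ_ℓ))^{(-1)^{i+1}}`, the formal consequence of
  Grothendieck's Lefschetz trace formula (1.5.1) — the accepted, *proved*
  `GaloisWeilCohomology.zetaSeries_mul_prod_frobCharPoly_holds` (`FrobeniusTraceProofs.lean`);
* Thm. (1.6): `det(1 - F*t, Hⁱ(X, ℚ_ℓ))` has integer coefficients and complex (reciprocal) roots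
  of absolute value `q^{i/2}` — the predicate `DeligneWeilIStatement E` of `WeilConjectures.lean`
  (`E.WeilRiemannHypothesisFor X n` for all smooth projective `X`);
* (2.3)–(2.5): Poincaré duality is a perfect pairing compatible with Frobenius and `F* = qⁿ` on
  `H²ⁿ(X)` for `X` connected ((2.5)(c)), whence `P₂ₙ = 1 - qⁿT`, and dually `F* = 1` on the line
  `H⁰(X)`, whence `P₀ = 1 - T`.

Precisely, for every Weil cohomology theory with Galois action
`E : Literature.AlgebraicGeometry.Motives.GaloisWeilCohomology k K χ` (coefficients `K` of
characteristic zero) satisfying the Lefschetz trace formula `E.HasLefschetzTraceFormula`, whose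
character takes the value `q` on the arithmetic Frobenius (`χ(φ) = q`, the normalisation of the
cyclotomic character, proved for `ℓ`-adic coefficients as
`Literature.AlgebraicGeometry.Motives.padicCyclotomicCharacter_arithFrob`), and satisfying
`DeligneWeilIStatement E`, the fact `exists_isWeilFactorization` holds over `k`
(`exists_isWeilFactorization_of_galoisWeilCohomology`); the integral models `Pᵢ ∈ ℤ[T]` of the
`det(1 - T·F | Hⁱ(X))` furnished by Deligne's theorem *are* the Weil factorisation
(`isWeilFactorization_of_isIntegralModel`). Consequently the fact follows from the single
existence statement "for every prime `ℓ` invertible in `k` there is a Galois Weil cohomology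
theory with `ℚ_ℓ`-coefficients and cyclotomic twist satisfying the trace formula and Deligne's
theorem (1.6)" — `ℓ`-adic étale cohomology (SGA 4, 4½, 5 and Deligne 1974) —
(`exists_isWeilFactorization_of_forall_prime`), which is the complete dependency of
`exists_isWeilFactorization` on unproved inputs; neither Mathlib nor the Literature tree
constructs étale cohomology with its Galois action.

## Main results

* `WeilFactorization.charpoly_eq_X_sub_C_of_finrank_eq_one`: an endomorphism acting as the
  scalar `c` on a line has characteristic polynomial `T - c`.
* `WeilFactorization.frobAction_apply_top`, `WeilFactorization.frobAction_apply_zero`: `F = qⁿ`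
  on `H²ⁿ(X)` (Deligne (2.5)(c)) and `F = 1` on `H⁰(X)` (by Poincaré duality) for a Galois Weil
  cohomology theory with `χ(φ) = q`.
* `WeilFactorization.frobCharPoly_top`, `WeilFactorization.frobCharPoly_zero`:
  `det(1 - T·F | H²ⁿ(X)) = 1 - qⁿT`, `det(1 - T·F | H⁰(X)) = 1 - T`.
* `isWeilFactorization_of_isIntegralModel`: integral models of the `det(1 - T·F | Hⁱ(X))`
  satisfying the Riemann hypothesis form a Weil factorisation of `Z(X, T)`.
* `exists_isWeilFactorization_of_galoisWeilCohomology`: the reduction of the named fact to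
  `(E, trace formula, χ(φ) = q, DeligneWeilIStatement E)`.
* `exists_isWeilFactorization_of_forall_prime`: the reduction to the existence, for the primes
  `ℓ` invertible in `k`, of `ℓ`-adic cohomology with the trace formula and Deligne's theorem.

## References

* P. Deligne, *La conjecture de Weil. I*, Publ. Math. IHÉS 43 (1974), (1.5.1)–(1.5.4),
  Thm. (1.6), (2.3)–(2.5), pp. 275–276, 281. [Deligne1974]
* A. Grothendieck, *Formule de Lefschetz et rationalité des fonctions L*, Sém. Bourbaki 279
  (1964/65), §5, Cor. 5.2. [Grothendieck1965]
* R. Hartshorne, *Algebraic Geometry* (1977), App. C, Thm. 1.3 and §4. [Hartshorne1977]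

## Design notes

* No definitions; helpers live in `namespace Literature.NumberTheory.LFunctions.WeilFactorization`.
  Schemes are called `Y` (`X` is the polynomial variable).
* The descent from `K⟦T⟧` to `ℚ⟦T⟧` is injectivity of `PowerSeries.map (algebraMap ℚ K)`; the
  descent of `P₀`, `P₂ₙ` from `K[T]` to `ℤ[T]` is injectivity of `Polynomial.map (ℤ → K)`
  (`char K = 0`). No rationality argument (Hankel determinants, Fatou) is needed here because
  Deligne's theorem is taken in its final form (1.6) (integral models), not in the form (1.7).
-/

universe u v

open Polynomial

noncomputable section

namespace Literature.NumberTheory.LFunctions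

namespace WeilFactorization

/-! ### Linear algebra: the characteristic polynomial of a scalar acting on a line -/

section LinearAlgebra

variable {K : Type*} [Field K] {V : Type*} [AddCommGroup V] [Module K V]

/-- An endomorphism `f` of a one-dimensional vector space acting as the scalar `c`
(`f v = c • v`) has characteristic polynomial `T - c` (`det f = c`, and the characteristic
polynomial is monic of degree one with constant term `-det f`). [folklore] -/
theorem charpoly_eq_X_sub_C_of_finrank_eq_one [FiniteDimensional K V]
    (h1 : Module.finrank K V = 1) {f : V →ₗ[K] V} {c : K} (hf : ∀ v, f v = c • v) :
    f.charpoly = X - C c := by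
  have hfc : f = c • LinearMap.id := LinearMap.ext fun v => by simpa using hf v
  have hdet : LinearMap.det f = c := by
    rw [hfc, LinearMap.det_smul, LinearMap.det_id, h1, pow_one, mul_one]
  have hdeg : f.charpoly.natDegree = 1 := by rw [LinearMap.charpoly_natDegree, h1]
  have h0 : f.charpoly.coeff 0 = -c := by
    have h := LinearMap.det_eq_sign_charpoly_coeff f
    rw [hdet, h1, pow_one, neg_one_mul] at h
    linear_combination h
  rw [f.charpoly_monic.eq_X_add_C hdeg, h0, C_neg, sub_eq_add_neg]

end LinearAlgebra

/-! ### Re-indexing products over `Fin (2n+1)` by parity -/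

section Reindex

/-- `∏_{i : Fin m, p i} g i = ∏_{i < m, p i} g i` for a predicate and a function of the
underlying natural number (`Fin.prod_univ_eq_prod_range` through `Finset.prod_filter`).
[folklore] -/
theorem prod_univ_filter_eq_prod_range_filter {M : Type*} [CommMonoid M] (m : ℕ) (p : ℕ → Prop)
    [DecidablePred p] (g : ℕ → M) :
    ∏ i ∈ (Finset.univ : Finset (Fin m)) with p i.val, g i.val =
      ∏ i ∈ (Finset.range m) with p i, g i := by
  rw [Finset.prod_filter, Finset.prod_filter]
  exact Fin.prod_univ_eq_prod_range (fun i => if p i then g i else 1) m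

end Reindex

/-! ### The cohomological input: Frobenius on `H⁰` and `H²ⁿ` -/

section Cohomology

open CategoryTheory _root_.AlgebraicGeometry
open Literature.AlgebraicGeometry.Motives (GaloisWeilCohomology SchemeOver IsSmoothProjective
  arithFrob)

variable {k : Type u} [Field k] [Finite k] {K : Type v} [Field K] [CharZero K]
  {χ : Field.absoluteGaloisGroup k →* Kˣ} (E : GaloisWeilCohomology k K χ)

/-- **`F = qⁿ` on `H²ⁿ(X)`** (Deligne, *Weil I*, (2.5)(c): "sur `H²ⁿ(X, ℚ_ℓ)`, `F*` est la
multiplication par `qⁿ`"): for a Galois Weil cohomology theory with `χ(φ) = q` and `X` smooth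
projective of dimension `n`, the geometric Frobenius acts on the line `H²ⁿ(X)` as the scalar
`qⁿ` (the trace `H²ⁿ(X) → K` is injective and `tr(F y) = qⁿ tr(y)`,
`WeilFunctionalEquation.trace_frobAction`). [cite: Deligne1974, (2.5)(c)] -/
theorem frobAction_apply_top (hχ : (χ (arithFrob k) : K) = Nat.card k) {n : ℕ} {Y : SchemeOver k}
    (hX : IsSmoothProjective n Y) (y : E.obj Y (2 * n)) :
    E.frobAction Y (2 * n) y = ((Nat.card k : K) ^ n) • y := by
  apply (E.bijective_trace hX).1
  rw [WeilFunctionalEquation.trace_frobAction E hχ hX y, LinearMap.map_smul, smul_eq_mul]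

/-- **`F = 1` on `H⁰(X)`** (Deligne, *Weil I*, (2.3)–(2.5); Hartshorne, App. C, §4): for a Galois
Weil cohomology theory with `χ(φ) = q` and `X` smooth projective of dimension `n`, the geometric
Frobenius acts trivially on `H⁰(X)`. Proof: the Poincaré pairing `H⁰ × H²ⁿ → K` is perfect
(`isPerfPair_cupPairing`) and satisfies `⟨F v, F w⟩ = qⁿ ⟨v, w⟩`
(`WeilFunctionalEquation.cupPairing_frobAction`), while `F w = qⁿ w` on `H²ⁿ`; hence
`⟨F v - v, w⟩ = 0` for all `w`. [cite: Deligne1974, (2.3)–(2.5)] -/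
theorem frobAction_apply_zero (hχ : (χ (arithFrob k) : K) = Nat.card k) {n : ℕ} {Y : SchemeOver k}
    (hX : IsSmoothProjective n Y) (v : E.obj Y 0) : E.frobAction Y 0 v = v := by
  haveI := E.isPerfPair_cupPairing hX 0 (2 * n) (zero_add _)
  apply (LinearMap.IsPerfPair.bijective_left (E.cupPairing Y n 0 (2 * n) (zero_add _))).1
  refine LinearMap.ext fun w => ?_
  have h := WeilFunctionalEquation.cupPairing_frobAction E hχ hX (zero_add (2 * n)) v w
  rw [frobAction_apply_top E hχ hX w, LinearMap.map_smul, smul_eq_mul] at h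
  exact mul_left_cancel₀ (pow_ne_zero _ (Nat.cast_ne_zero.mpr Nat.card_pos.ne')) h

/-- **`det(1 - T·F | H²ⁿ(X)) = 1 - qⁿT`** for `X` smooth projective of dimension `n` and a
Galois Weil cohomology theory with `χ(φ) = q` (Deligne, *Weil I*, (2.5)(c) with
`dim H²ⁿ(X) = 1`; Hartshorne, App. C, Thm. 1.3: `P₂ₙ(t) = 1 - qⁿt`). [cite: Deligne1974, (2.5)(c)] -/
theorem frobCharPoly_top (hχ : (χ (arithFrob k) : K) = Nat.card k) {n : ℕ} {Y : SchemeOver k}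
    (hX : IsSmoothProjective n Y) :
    E.frobCharPoly Y (2 * n) = 1 - C ((Nat.card k : K) ^ n) * X := by
  haveI := E.finite_obj hX (2 * n)
  rw [E.frobCharPoly_of_finite, charpoly_eq_X_sub_C_of_finrank_eq_one (E.finrank_obj_two_mul hX)
    (frobAction_apply_top E hχ hX), WeilFunctionalEquation.reverse_X_sub_C_eq]

/-- **`det(1 - T·F | H⁰(X)) = 1 - T`** for `X` smooth projective (geometrically irreducible) and
a Galois Weil cohomology theory with `χ(φ) = q` (`F = 1` on the line `H⁰(X)`; Hartshorne,
App. C, Thm. 1.3: `P₀(t) = 1 - t`). [cite: Deligne1974, (2.3)–(2.5)] -/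
theorem frobCharPoly_zero (hχ : (χ (arithFrob k) : K) = Nat.card k) {n : ℕ} {Y : SchemeOver k}
    (hX : IsSmoothProjective n Y) : E.frobCharPoly Y 0 = 1 - X := by
  haveI := E.finite_obj hX 0
  rw [E.frobCharPoly_of_finite, charpoly_eq_X_sub_C_of_finrank_eq_one (E.finrank_obj_zero hX)
    (c := 1) (fun v => by rw [one_smul]; exact frobAction_apply_zero E hχ hX v),
    WeilFunctionalEquation.reverse_X_sub_C_eq, map_one, one_mul]

end Cohomology

end WeilFactorization

/-! ### The Weil factorisation of `Z(X, T)` from integral models of the `det(1 - T·F | Hⁱ)` -/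

section RH

open CategoryTheory _root_.AlgebraicGeometry WeilFactorization
open Literature.AlgebraicGeometry.Motives (GaloisWeilCohomology SchemeOver IsSmoothProjective
  IsWeilFactorization zetaSeries arithFrob padicCyclotomicCharacter)

variable {k : Type u} [Field k] [Finite k] {K : Type v} [Field K] [CharZero K]
  {χ : Field.absoluteGaloisGroup k →* Kˣ} (E : GaloisWeilCohomology k K χ)

/-- **Integral models of the Frobenius characteristic polynomials are a Weil factorisation**
(Deligne, *Weil I*, (1.5.4) with Thm. (1.6) and (2.5)(c); Hartshorne, App. C, Thm. 1.3 ⟸ §4).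
Let `E` be a Galois Weil cohomology theory over the finite field `k` (`q = #k`) satisfying the
Lefschetz trace formula and `χ(φ) = q`, `X` smooth projective of dimension `n`, and
`Pᵢ ∈ ℤ[T]` (`i ≤ 2n`) integral models of `det(1 - T·F | Hⁱ(X))` (`E.IsIntegralModel`) all of
whose complex roots have absolute value `q^{-i/2}`. Then `(Pᵢ)` is a Weil factorisation of
`Z(X, T)`: `Pᵢ(0) = 1` (`coeff_zero_frobCharPoly`), `Z · ∏_{even} Pᵢ = ∏_{odd} Pᵢ` in `ℚ⟦T⟧`
(the proved cohomological expression `zetaSeries_mul_prod_frobCharPoly_holds` in `K⟦T⟧`,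
descended along the injection `ℚ⟦T⟧ → K⟦T⟧`), `P₀ = 1 - T` and `P₂ₙ = 1 - qⁿT`
(`frobCharPoly_zero`, `frobCharPoly_top`, descended along `ℤ[T] → K[T]`).
[cite: Deligne1974, (1.5.4), Thm. (1.6), (2.5)(c)] -/
theorem isWeilFactorization_of_isIntegralModel (hE : E.HasLefschetzTraceFormula)
    (hχ : (χ (arithFrob k) : K) = Nat.card k) {n : ℕ} {Y : SchemeOver k}
    (hX : IsSmoothProjective n Y) {P : Fin (2 * n + 1) → ℤ[X]}
    (hP : ∀ i : Fin (2 * n + 1), E.IsIntegralModel Y i (P i))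
    (hRH : ∀ (i : Fin (2 * n + 1)) (z : ℂ), ((P i).map (Int.castRingHom ℂ)).IsRoot z →
      ‖z‖ = (Nat.card k : ℝ) ^ (-((i : ℕ) : ℝ) / 2)) :
    IsWeilFactorization (Nat.card k) n (zetaSeries Y) P := by
  have hP' : ∀ i : Fin (2 * n + 1), (P i).map (Int.castRingHom K) = E.frobCharPoly Y i := hP
  have hinj : Function.Injective (Int.castRingHom K) := Int.cast_injective
  refine ⟨fun i => ?_, ?_, ?_, ?_, hRH⟩
  · -- constant terms: `Pᵢ(0) = 1`
    have h := congrArg (fun p : K[X] => p.coeff 0) (hP' i)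
    simp only [Polynomial.coeff_map, eq_intCast, E.coeff_zero_frobCharPoly] at h
    exact_mod_cast h
  · -- the identity `Z · ∏_{even} Pᵢ = ∏_{odd} Pᵢ`, descended from `K⟦T⟧`
    apply PowerSeries.map_injective (algebraMap ℚ K) (algebraMap ℚ K).injective
    have hcomp : (algebraMap ℚ K).comp (Int.castRingHom ℚ) = Int.castRingHom K :=
      RingHom.ext_int _ _
    have hPK : ∀ i : Fin (2 * n + 1), PowerSeries.map (algebraMap ℚ K)
        ((P i).map (Int.castRingHom ℚ) : PowerSeries ℚ) = (E.frobCharPoly Y i : PowerSeries K) :=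
      fun i => by rw [← Polynomial.polynomial_map_coe, Polynomial.map_map, hcomp, hP' i]
    rw [map_mul, map_prod, map_prod]
    simp_rw [hPK]
    rw [prod_univ_filter_eq_prod_range_filter (2 * n + 1) Even
        (fun i => (E.frobCharPoly Y i : PowerSeries K)),
      prod_univ_filter_eq_prod_range_filter (2 * n + 1) Odd
        (fun i => (E.frobCharPoly Y i : PowerSeries K))]
    exact E.zetaSeries_mul_prod_frobCharPoly_holds hE hX
  · -- `P₀ = 1 - T`
    apply Polynomial.map_injective (Int.castRingHom K) hinj
    rw [hP' 0, Fin.val_zero, frobCharPoly_zero E hχ hX, Polynomial.map_sub, Polynomial.map_one,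
      Polynomial.map_X]
  · -- `P₂ₙ = 1 - qⁿ T`
    apply Polynomial.map_injective (Int.castRingHom K) hinj
    rw [hP' (Fin.last (2 * n)), Fin.val_last, frobCharPoly_top E hχ hX, Polynomial.map_sub,
      Polynomial.map_one, Polynomial.map_mul, Polynomial.map_C, Polynomial.map_X, eq_intCast,
      Int.cast_pow, Int.cast_natCast]

/-- **The Weil conjectures for `Z(X, T)` from the cohomological formalism and Deligne's theorem**
(Deligne, *La conjecture de Weil. I* (1974): (1.5.4), Thm. (1.6), (2.5)(c); Grothendieck, Sém.
Bourbaki 279, Cor. 5.2; Hartshorne, App. C, Thm. 1.3 and §4). Let `E` be a Weil cohomology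
theory with Galois action on smooth projective varieties over the finite field `k` (`q = #k`)
which satisfies the Lefschetz trace formula, whose character satisfies `χ(φ) = q` on the
arithmetic Frobenius, and for which Deligne's theorem (1.6) holds (`DeligneWeilIStatement E`:
integral models of `det(1 - T·F | Hⁱ(X))` with all complex roots of absolute value `q^{-i/2}`).
Then the named fact `Literature.NumberTheory.LFunctions.exists_isWeilFactorization` holds over
`k`: every smooth projective `X` of dimension `n` has a Weil factorisation
`Z(X, T) = ∏ Pᵢ^{(-1)^{i+1}}`, `P₀ = 1 - T`, `P₂ₙ = 1 - qⁿT`, `|roots of Pᵢ| = q^{-i/2}`. All three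
hypotheses are theorems for `ℓ`-adic étale cohomology, `ℓ ∤ q` (Grothendieck, SGA 4, 4½, 5;
Deligne 1974). [cite: Deligne1974, Thm. (1.6)] -/
theorem exists_isWeilFactorization_of_galoisWeilCohomology (E : GaloisWeilCohomology k K χ)
    (hE : E.HasLefschetzTraceFormula) (hχ : (χ (arithFrob k) : K) = Nat.card k)
    (hD : DeligneWeilIStatement E) : exists_isWeilFactorization (k := k) := by
  intro n Y hX
  obtain ⟨P, hP, hRH⟩ := hD hX
  exact ⟨P, isWeilFactorization_of_isIntegralModel E hE hχ hX hP hRH⟩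

/-- **The Weil conjectures for `Z(X, T)`, granted `ℓ`-adic cohomology with Deligne's theorem.**
If for every prime `ℓ` invertible in the finite field `k` there is a Weil cohomology theory with
Galois action `E : GaloisWeilCohomology k ℚ_ℓ χ_ℓ`, `χ_ℓ` the `ℓ`-adic cyclotomic character,
satisfying the Lefschetz trace formula and Deligne's theorem (1.6) — as `ℓ`-adic étale cohomology
`X ↦ H•(X_{k̄}, ℚ_ℓ)` does (Grothendieck, SGA 4, 4½, 5: Deligne 1974, (1.5.1), (2.3)–(2.4);
Deligne 1974, Thm. (1.6)) — then `exists_isWeilFactorization` holds over `k`: choose a prime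
`ℓ ≠ char k`, use `χ_ℓ(φ) = q` (`padicCyclotomicCharacter_arithFrob`) and
`exists_isWeilFactorization_of_galoisWeilCohomology`. This is the complete dependency of the named
fact on unproved inputs. [cite: Deligne1974, Thm. (1.6)] -/
theorem exists_isWeilFactorization_of_forall_prime
    (h : ∀ (ℓ : ℕ) [Fact ℓ.Prime], (ℓ : k) ≠ 0 →
      ∃ E : GaloisWeilCohomology k ℚ_[ℓ] (padicCyclotomicCharacter k ℓ),
        E.HasLefschetzTraceFormula ∧ DeligneWeilIStatement E) :
    exists_isWeilFactorization (k := k) := by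
  -- a prime `ℓ` invertible in `k`: any prime above the characteristic
  obtain ⟨p, hp⟩ := CharP.exists k
  have hpp : p.Prime := CharP.char_is_prime k p
  obtain ⟨ℓ, hle, hℓp⟩ := Nat.exists_infinite_primes (p + 1)
  have hℓ : (ℓ : k) ≠ 0 := fun h0 => by
    rw [CharP.cast_eq_zero_iff k p ℓ, Nat.prime_dvd_prime_iff_eq hpp hℓp] at h0
    omega
  haveI : Fact ℓ.Prime := ⟨hℓp⟩
  obtain ⟨E, hE, hD⟩ := h ℓ hℓ
  intro n Y hX
  exact exists_isWeilFactorization_of_galoisWeilCohomology E hE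
    (Literature.AlgebraicGeometry.Motives.padicCyclotomicCharacter_arithFrob ℓ hℓ) hD hX

end RH

end Literature.NumberTheory.LFunctions

end
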